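import Literature.MathematicalPhysics.QuantumLattice.HubbardChemicalPotentialTL
import Literature.MathematicalPhysics.QuantumLattice.HubbardNNNHoppingEnergyDensityRegionBounds
import HarnessLib

/-!
# The SCALE coordinate `t` of a downfolded Hubbard box: positive homogeneity of the `t–t'`
# Hamiltonian, of its sector ground states, of the energy density and of the chemical potentials

Topic `MathematicalPhysics/QuantumLattice` (family `hubbard`); namespace
`Literature.MathematicalPhysics.QuantumLattice` (finite volume) and `….ThermodynamicLimit` (energy
density, chemical potentials). Written for the material-oracle pipeline: a downfolded single-band box
arrives in the coordinates `(U/t, t'/t, n)` PLUS a scale `t_eV ∈ [t₁, t₂]` (eV), whereas every certified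
word is produced at `t = 1`. The `t–t'` Hubbard Hamiltonian
`H(t, t', U) = -t T - t' T' + U D` (`hubbardTorusTT'`, Xu et al. (2024) eq. (1)) is LINEAR in the
coupling vector, so `H(ct, ct', cU) = c • H(t, t', U)` (`hubbardTorusTT'_smul`); consequently, for
`c > 0`:

* §1 SECTOR GROUND STATES ARE SCALE-FREE: `minEnergyOn (c • A) K = c · minEnergyOn A K` (`c ≥ 0`,
  `Matrix.minEnergyOn_real_smul`), hence `IsGroundStateInSector (c • H) N M ψ ↔ IsGroundStateInSector H N M ψ`
  (`isGroundStateInSector_real_smul_iff`) and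
  `IsGroundStateInSector (hubbardTorusTT' L (ct) (ct') (cU)) N M ψ ↔ IsGroundStateInSector (hubbardTorusTT' L t t' U) N M ψ`
  (`isGroundStateInSector_hubbardTorusTT'_scale_iff`). Every word that quantifies over (torus limits
  of) sector ground states — correlator ceilings/floors, pair-correlation words, double occupancy,
  momentum distribution — therefore depends on `(U/t, t'/t, n)` only: the scale box `[t₁, t₂]` is IDLE
  for dimensionless words (this is the "dimensionless rescaling lemma" the box grammar relies on when it
  lists `U/t`, `tp/t`, `n` first and `t_eV` as a separate coordinate).
* §2 ENERGY WORDS carry one power of the scale: the tree's `energyDensityTT'_smul` /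
  `energyDensityTT'_eq_mul_unit` (`e(t, t', U, n) = t · e(1, t'/t, U/t, n)`), read over a scale box:
  a dimensionless window `w_lo ≤ e(1, τ, u, n) ≤ w_hi` gives
  `min (t₁ w_lo) (t₂ w_lo) ≤ e(t, tτ, tu, n) ≤ max (t₁ w_hi) (t₂ w_hi)` for every `t ∈ [t₁, t₂]`,
  `0 ≤ t₁` (`energyDensityTT'_scale_mem_Icc`; the `min`/`max` absorb the sign of the window).
* §3 CHEMICAL POTENTIALS and the charge gap carry one power of the scale:
  `μ±(ct, ct', cU, n) = c μ±(t, t', U, n)`, `Δ_c(ct, ct', cU, n) = c Δ_c(t, t', U, n)` (`c ≥ 0`,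
  `0 < n < 2`, `U ≥ 0`; `chemPotPlusTT'_smul`, `chemPotMinusTT'_smul`, `chargeGapTT'_smul`) and the
  unit forms `μ±(t, t', U, n) = t μ±(1, t'/t, U/t, n)` (`chemPotPlusTT'_eq_mul_unit`,
  `chemPotMinusTT'_eq_mul_unit`, `chargeGapTT'_eq_mul_unit`).
* §4 THERMAL STATES AND FIELDS (the `T` and `H` axes of a phase map): `e^{-β(c•H)} = e^{-(βc)H}`, so
  Gibbs weight / partition function / Gibbs state of `c • H` at `β` are those of `H` at `βc`
  (`Matrix.gibbsWeight_real_smul`, `Matrix.partitionFn_real_smul`, `Matrix.gibbsState_real_smul`); the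
  grand-canonical `t–t'` torus with a Zeeman field is linear in all five couplings
  (`hubbardTorusTT'_sub_chemPot_sub_field_smul`), hence every thermal expectation of
  `H(t, t', U) - μ N - h S^z` at `β` is that of the unit model `H(1, t'/t, U/t) - (μ/t) N - (h/t) S^z` at
  `βt` (`gibbsState_hubbardTorusTT'_grandCanonical_eq_unit`, canonical `gibbsState_hubbardTorusTT'_eq_unit`,
  `partitionFn_hubbardTorusTT'_grandCanonical_scale`): thermal words depend on
  `(U/t, t'/t, μ/t, h/t, k_B T/t)` only and the kelvin / tesla axes carry one power of `t_eV`.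

HONEST LIMITS. Dimensional analysis only: nothing here bounds the dependence of a word on the
dimensionless coordinates (that is the business of the `(U/t, t'/t)` region bounds and of the
filling-box files); temperatures and fields scale like energies (§4 is the exact covariance, nothing
quantitative). Everything is PROVED; no definition, no named fact, no sorry.

## Tree search (cited, not restated)

`hubbardRectTorusTT'_smul`, `groundEnergy_hubbardRectTorusTT'_smul`, `energyDensityTT'_smul`,
`energyDensityTT'_eq_mul_unit` (the rectangular-torus / energy-density homogeneity already in
`HubbardNNNHoppingEnergyDensityRegionBounds` §6), `hasDerivWithinAt_chemPotPlusTT'`,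
`hasDerivWithinAt_chemPotMinusTT'`, `IsGroundStateInSector`, `Matrix.minEnergyOn`, `Matrix.gibbsWeight`,
`Matrix.partitionFn`, `Matrix.gibbsState` (`FinDimSpectrum`), `totalNumber`, `HubbardWave0.spinZ`;
Mathlib `Real.sInf_smul_of_nonneg`, `HasDerivWithinAt.const_mul`, `HasDerivWithinAt.congr_of_mem`.

## References

* H. Xu, C.-M. Chung, M. Qin, U. Schollwöck, S. R. White, S. Zhang, Science 384 (2024) eadh7691,
  eq. (1) (the `t–t'` Hubbard Hamiltonian; energies in units of `t`). [cite: XuEtAl2024, eq. (1)]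
* T. Koma, H. Tasaki, J. Stat. Phys. 76 (1994) 745, §1 (sector ground-state energies as infima of
  linear functionals of the couplings). [cite: KomaTasaki1994, §1]
* D. Ruelle, *Statistical Mechanics: Rigorous Results* (1969), §3.3–§3.4 (thermodynamic functions are
  positively homogeneous in the interaction; chemical potentials as density derivatives).
  [cite: Ruelle1969, §3.3]
-/

noncomputable section

namespace Literature.MathematicalPhysics.QuantumLattice

open Matrix Set HubbardWave0 Literature.Probability.LatticeModels
open scoped Pointwise

/-! ### §1 The Hamiltonian and its sector ground states are positively homogeneous -/

/-- `H(ct, ct', cU) = c • H(t, t', U)` on the square torus: rescaling all couplings rescales the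
`t–t'` Hamiltonian (the rectangular-torus form is `hubbardRectTorusTT'_smul`). [cite: XuEtAl2024, eq. (1)] -/
theorem hubbardTorusTT'_smul (L : ℕ) (c t t' U : ℝ) :
    hubbardTorusTT' L (c * t) (c * t') (c * U) = (c : ℂ) • hubbardTorusTT' L t t' U := by
  ext i j
  simp only [hubbardTorusTT', hamiltonian, Matrix.add_apply, Matrix.smul_apply, smul_eq_mul]
  push_cast
  ring

/-- **Positive homogeneity of the sector energy** (dot-notation extension of Mathlib's `Matrix`): for
`c ≥ 0`, `minEnergyOn (c • A) K = c · minEnergyOn A K` — the Rayleigh quotients of `c • A` are `c` times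
those of `A` and `sInf (c • S) = c · sInf S`. (The same statement is proved Summits-side as
`Summit.HubbardSuperconductivity.HubbardSuperconductivity.Theorems.CooperPairDMottWalk.minEnergyOn_real_smul`,
which a Literature file cannot import; this is the Literature-side home.) [cite: KomaTasaki1994, §1] -/
theorem _root_.Matrix.minEnergyOn_real_smul {m : Type*} [Fintype m] [DecidableEq m] (A : Matrix m m ℂ)
    (K : Submodule ℂ (m → ℂ)) {c : ℝ} (hc : 0 ≤ c) :
    ((c : ℂ) • A).minEnergyOn K = c * A.minEnergyOn K := by
  unfold Matrix.minEnergyOn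
  have hset : {E : ℝ | ∃ ψ ∈ K, star ψ ⬝ᵥ ψ = 1 ∧ E = (star ψ ⬝ᵥ ((c : ℂ) • A) *ᵥ ψ).re} =
      c • {E : ℝ | ∃ ψ ∈ K, star ψ ⬝ᵥ ψ = 1 ∧ E = (star ψ ⬝ᵥ A *ᵥ ψ).re} := by
    ext E
    simp only [Set.mem_setOf_eq, Set.mem_smul_set, smul_eq_mul]
    constructor
    · rintro ⟨ψ, hK, h1, rfl⟩
      exact ⟨_, ⟨ψ, hK, h1, rfl⟩, by
        rw [Matrix.smul_mulVec, dotProduct_smul, smul_eq_mul, Complex.re_ofReal_mul]⟩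
    · rintro ⟨E', ⟨ψ, hK, h1, rfl⟩, rfl⟩
      exact ⟨ψ, hK, h1, by
        rw [Matrix.smul_mulVec, dotProduct_smul, smul_eq_mul, Complex.re_ofReal_mul]⟩
  rw [hset, Real.sInf_smul_of_nonneg hc, smul_eq_mul]

/-- **Sector ground states are scale-free**: for `c > 0`, `ψ` is a ground state of `c • H` in the
sector `(N, S^z = M)` iff it is one of `H` (same sector, same eigenvector; the eigenvalue scales by
`c`). (Also proved Summits-side as `…Theorems.CooperPairDMottWalk.isGroundStateInSector_real_smul_iff`,
not importable into Literature.) [cite: KomaTasaki1994, §1] -/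
theorem isGroundStateInSector_real_smul_iff {Λ : Type*} [LinearOrder Λ] [Fintype Λ]
    (H : Matrix (Finset (Orb Λ)) (Finset (Orb Λ)) ℂ) (N : ℕ) (M : ℝ) (ψ : Fock (Orb Λ)) {c : ℝ}
    (hc : 0 < c) :
    IsGroundStateInSector ((c : ℂ) • H) N M ψ ↔ IsGroundStateInSector H N M ψ := by
  have hc' : (c : ℂ) ≠ 0 := Complex.ofReal_ne_zero.2 hc.ne'
  simp only [IsGroundStateInSector, Matrix.minEnergyOn_real_smul H _ hc.le, Matrix.smul_mulVec,
    Complex.ofReal_mul, mul_smul]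
  rw [smul_right_inj hc']

/-- **THE DIMENSIONLESS RESCALING LEMMA (finite volume).** For `c > 0`, every torus side `L`, every
sector `(N, M)` and every vector `ψ`:
`IsGroundStateInSector (H(ct, ct', cU)) N M ψ ↔ IsGroundStateInSector (H(t, t', U)) N M ψ` — the sector
ground states of the `t–t'` Hubbard torus, hence their torus limits and every expectation value taken in
them, depend on the couplings only through `(U/t, t'/t)`. [cite: XuEtAl2024, eq. (1)]
[cite: KomaTasaki1994, §1] -/
theorem isGroundStateInSector_hubbardTorusTT'_scale_iff (L : ℕ) (t t' U : ℝ) {c : ℝ} (hc : 0 < c)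
    (N : ℕ) (M : ℝ) (ψ : Fock (Orb (FermionTorus 2 L))) :
    IsGroundStateInSector (hubbardTorusTT' L (c * t) (c * t') (c * U)) N M ψ ↔
      IsGroundStateInSector (hubbardTorusTT' L t t' U) N M ψ := by
  rw [hubbardTorusTT'_smul, isGroundStateInSector_real_smul_iff _ _ _ _ hc]

/-- **Unit form**: for `t > 0` the sector ground states of `H(t, t', U)` are exactly those of
`H(1, t'/t, U/t)`. [cite: XuEtAl2024, eq. (1)] -/
theorem isGroundStateInSector_hubbardTorusTT'_iff_unit (L : ℕ) {t : ℝ} (ht : 0 < t) (t' U : ℝ)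
    (N : ℕ) (M : ℝ) (ψ : Fock (Orb (FermionTorus 2 L))) :
    IsGroundStateInSector (hubbardTorusTT' L t t' U) N M ψ ↔
      IsGroundStateInSector (hubbardTorusTT' L 1 (t' / t) (U / t)) N M ψ := by
  have h := isGroundStateInSector_hubbardTorusTT'_scale_iff L 1 (t' / t) (U / t) ht N M ψ
  rwa [mul_one, mul_div_cancel₀ _ ht.ne', mul_div_cancel₀ _ ht.ne'] at h

namespace ThermodynamicLimit

/-! ### §2 Energy words over a scale box -/

/-- **Energy word over a SCALE BOX.** A dimensionless window `w_lo ≤ e(1, τ, u, n) ≤ w_hi`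
(`u ≥ 0`, `0 ≤ n < 2`) and a scale `t ∈ [t₁, t₂]`, `0 ≤ t₁`, give
`min (t₁ w_lo) (t₂ w_lo) ≤ e(t, t τ, t u, n) ≤ max (t₁ w_hi) (t₂ w_hi)` — the physical (eV) energy
window of the box from the `t = 1` word, endpoints of the scale interval only. [cite: Ruelle1969, §3.3] -/
theorem energyDensityTT'_scale_mem_Icc (τ : ℝ) {u : ℝ} (hu : 0 ≤ u) {n : ℝ} (hn0 : 0 ≤ n)
    (hn2 : n < 2) {w_lo w_hi t₁ t₂ t : ℝ} (ht₁ : 0 ≤ t₁) (ht : t ∈ Icc t₁ t₂)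
    (hlo : w_lo ≤ energyDensityTT' 1 τ u n) (hhi : energyDensityTT' 1 τ u n ≤ w_hi) :
    min (t₁ * w_lo) (t₂ * w_lo) ≤ energyDensityTT' t (t * τ) (t * u) n ∧
      energyDensityTT' t (t * τ) (t * u) n ≤ max (t₁ * w_hi) (t₂ * w_hi) := by
  have ht0 : 0 ≤ t := ht₁.trans ht.1
  have h := energyDensityTT'_smul 1 τ hu hn0 hn2 ht0
  rw [mul_one] at h
  rw [h]
  constructor
  · -- `min (t₁ w) (t₂ w) ≤ t w ≤ t e`
    have h1 : t * w_lo ≤ t * energyDensityTT' 1 τ u n := mul_le_mul_of_nonneg_left hlo ht0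
    refine le_trans ?_ h1
    rcases le_total 0 w_lo with hw | hw
    · exact (min_le_left _ _).trans (mul_le_mul_of_nonneg_right ht.1 hw)
    · exact (min_le_right _ _).trans (mul_le_mul_of_nonpos_right ht.2 hw)
  · have h1 : t * energyDensityTT' 1 τ u n ≤ t * w_hi := mul_le_mul_of_nonneg_left hhi ht0
    refine h1.trans ?_
    rcases le_total 0 w_hi with hw | hw
    · exact le_trans (mul_le_mul_of_nonneg_right ht.2 hw) (le_max_right _ _)
    · exact le_trans (mul_le_mul_of_nonpos_right ht.1 hw) (le_max_left _ _)

/-! ### §3 Chemical potentials and the charge gap carry one power of the scale -/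

/-- On `[0, 2)` the energy density at rescaled couplings is `c` times the energy density (pointwise
form of `energyDensityTT'_smul` as an equality of functions on the density domain). [cite: Ruelle1969, §3.3] -/
theorem energyDensityTT'_smul_eqOn (t t' : ℝ) {U : ℝ} (hU : 0 ≤ U) {c : ℝ} (hc : 0 ≤ c) :
    EqOn (energyDensityTT' (c * t) (c * t') (c * U)) (fun x => c * energyDensityTT' t t' U x)
      (Ico (0 : ℝ) 2) :=
  fun _ hx => energyDensityTT'_smul t t' hU hx.1 hx.2 hc

/-- **`μ₊` is positively homogeneous in the couplings**: `μ₊(ct, ct', cU, n) = c μ₊(t, t', U, n)`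
for `c ≥ 0`, `U ≥ 0`, `0 < n < 2` (the right derivative of `c · e`). [cite: Ruelle1969, §3.3]
[cite: LiebWuPhysicaA2003, §7] -/
theorem chemPotPlusTT'_smul (t t' : ℝ) {U : ℝ} (hU : 0 ≤ U) {n : ℝ} (hn0 : 0 < n) (hn2 : n < 2)
    {c : ℝ} (hc : 0 ≤ c) :
    chemPotPlusTT' (c * t) (c * t') (c * U) n = c * chemPotPlusTT' t t' U n := by
  have hd := (hasDerivWithinAt_chemPotPlusTT' t t' hU hn0 hn2).const_mul c
  -- the two functions agree on `(n, 2) ⊆ Ioi n` near `n`, and at `n`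
  have hd' : HasDerivWithinAt (energyDensityTT' (c * t) (c * t') (c * U))
      (c * chemPotPlusTT' t t' U n) (Ioi n) n := by
    refine hd.congr_of_eventuallyEq ?_ (energyDensityTT'_smul t t' hU hn0.le hn2 hc)
    have hmem : Iio (2 : ℝ) ∈ nhdsWithin n (Ioi n) := mem_nhdsWithin_of_mem_nhds (Iio_mem_nhds hn2)
    filter_upwards [hmem, self_mem_nhdsWithin] with x hx2 hxn
    exact energyDensityTT'_smul t t' hU (hn0.trans hxn).le hx2 hc
  rw [chemPotPlusTT', hd'.derivWithin (uniqueDiffWithinAt_Ioi n)]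

/-- **`μ₋` is positively homogeneous in the couplings**: `μ₋(ct, ct', cU, n) = c μ₋(t, t', U, n)`
for `c ≥ 0`, `U ≥ 0`, `0 < n < 2`. [cite: Ruelle1969, §3.3] [cite: LiebWuPhysicaA2003, §7] -/
theorem chemPotMinusTT'_smul (t t' : ℝ) {U : ℝ} (hU : 0 ≤ U) {n : ℝ} (hn0 : 0 < n) (hn2 : n < 2)
    {c : ℝ} (hc : 0 ≤ c) :
    chemPotMinusTT' (c * t) (c * t') (c * U) n = c * chemPotMinusTT' t t' U n := by
  have hd := (hasDerivWithinAt_chemPotMinusTT' t t' hU hn0 hn2).const_mul c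
  have hd' : HasDerivWithinAt (energyDensityTT' (c * t) (c * t') (c * U))
      (c * chemPotMinusTT' t t' U n) (Iio n) n := by
    refine hd.congr_of_eventuallyEq ?_ (energyDensityTT'_smul t t' hU hn0.le hn2 hc)
    have hmem : Ioi (0 : ℝ) ∈ nhdsWithin n (Iio n) := mem_nhdsWithin_of_mem_nhds (Ioi_mem_nhds hn0)
    filter_upwards [hmem, self_mem_nhdsWithin] with x hx0 hxn
    exact energyDensityTT'_smul t t' hU (le_of_lt hx0) (lt_trans hxn hn2) hc
  rw [chemPotMinusTT', hd'.derivWithin (uniqueDiffWithinAt_Iio n)]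

/-- **The charge gap is positively homogeneous in the couplings**:
`Δ_c(ct, ct', cU, n) = c Δ_c(t, t', U, n)` (`c ≥ 0`, `U ≥ 0`, `0 < n < 2`).
[cite: LiebWuPhysicaA2003, §7] -/
theorem chargeGapTT'_smul (t t' : ℝ) {U : ℝ} (hU : 0 ≤ U) {n : ℝ} (hn0 : 0 < n) (hn2 : n < 2)
    {c : ℝ} (hc : 0 ≤ c) :
    chargeGapTT' (c * t) (c * t') (c * U) n = c * chargeGapTT' t t' U n := by
  rw [chargeGapTT', chargeGapTT', chemPotPlusTT'_smul t t' hU hn0 hn2 hc,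
    chemPotMinusTT'_smul t t' hU hn0 hn2 hc, mul_sub]

/-- **Unit form of `μ₊`**: `μ₊(t, t', U, n) = t μ₊(1, t'/t, U/t, n)` for `t > 0` (`U ≥ 0`,
`0 < n < 2`) — chemical-potential words certified at `t = 1` are read back in eV by one
multiplication. [cite: LiebWuPhysicaA2003, §7] -/
theorem chemPotPlusTT'_eq_mul_unit {t : ℝ} (ht : 0 < t) (t' : ℝ) {U : ℝ} (hU : 0 ≤ U) {n : ℝ}
    (hn0 : 0 < n) (hn2 : n < 2) :
    chemPotPlusTT' t t' U n = t * chemPotPlusTT' 1 (t' / t) (U / t) n := by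
  have h := chemPotPlusTT'_smul 1 (t' / t) (div_nonneg hU ht.le) hn0 hn2 ht.le
  rwa [mul_one, mul_div_cancel₀ _ ht.ne', mul_div_cancel₀ _ ht.ne'] at h

/-- **Unit form of `μ₋`**: `μ₋(t, t', U, n) = t μ₋(1, t'/t, U/t, n)` for `t > 0` (`U ≥ 0`,
`0 < n < 2`). [cite: LiebWuPhysicaA2003, §7] -/
theorem chemPotMinusTT'_eq_mul_unit {t : ℝ} (ht : 0 < t) (t' : ℝ) {U : ℝ} (hU : 0 ≤ U) {n : ℝ}
    (hn0 : 0 < n) (hn2 : n < 2) :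
    chemPotMinusTT' t t' U n = t * chemPotMinusTT' 1 (t' / t) (U / t) n := by
  have h := chemPotMinusTT'_smul 1 (t' / t) (div_nonneg hU ht.le) hn0 hn2 ht.le
  rwa [mul_one, mul_div_cancel₀ _ ht.ne', mul_div_cancel₀ _ ht.ne'] at h

/-- **Unit form of the charge gap**: `Δ_c(t, t', U, n) = t Δ_c(1, t'/t, U/t, n)` for `t > 0`
(`U ≥ 0`, `0 < n < 2`). [cite: LiebWuPhysicaA2003, §7] -/
theorem chargeGapTT'_eq_mul_unit {t : ℝ} (ht : 0 < t) (t' : ℝ) {U : ℝ} (hU : 0 ≤ U) {n : ℝ}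
    (hn0 : 0 < n) (hn2 : n < 2) :
    chargeGapTT' t t' U n = t * chargeGapTT' 1 (t' / t) (U / t) n := by
  rw [chargeGapTT', chargeGapTT', chemPotPlusTT'_eq_mul_unit ht t' hU hn0 hn2,
    chemPotMinusTT'_eq_mul_unit ht t' hU hn0 hn2, mul_sub]

/-- **Chemical-potential word over a SCALE BOX**: a dimensionless window `m_lo ≤ μ₊(1, τ, u, n) ≤ m_hi`
(`u ≥ 0`, `0 < n < 2`) and `t ∈ [t₁, t₂]`, `0 ≤ t₁`, give
`min (t₁ m_lo) (t₂ m_lo) ≤ μ₊(t, tτ, tu, n) ≤ max (t₁ m_hi) (t₂ m_hi)`. [cite: LiebWuPhysicaA2003, §7] -/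
theorem chemPotPlusTT'_scale_mem_Icc (τ : ℝ) {u : ℝ} (hu : 0 ≤ u) {n : ℝ} (hn0 : 0 < n)
    (hn2 : n < 2) {m_lo m_hi t₁ t₂ t : ℝ} (ht₁ : 0 ≤ t₁) (ht : t ∈ Icc t₁ t₂)
    (hlo : m_lo ≤ chemPotPlusTT' 1 τ u n) (hhi : chemPotPlusTT' 1 τ u n ≤ m_hi) :
    min (t₁ * m_lo) (t₂ * m_lo) ≤ chemPotPlusTT' t (t * τ) (t * u) n ∧
      chemPotPlusTT' t (t * τ) (t * u) n ≤ max (t₁ * m_hi) (t₂ * m_hi) := by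
  have ht0 : 0 ≤ t := ht₁.trans ht.1
  have h := chemPotPlusTT'_smul 1 τ hu hn0 hn2 ht0
  rw [mul_one] at h
  rw [h]
  constructor
  · have h1 : t * m_lo ≤ t * chemPotPlusTT' 1 τ u n := mul_le_mul_of_nonneg_left hlo ht0
    refine le_trans ?_ h1
    rcases le_total 0 m_lo with hw | hw
    · exact (min_le_left _ _).trans (mul_le_mul_of_nonneg_right ht.1 hw)
    · exact (min_le_right _ _).trans (mul_le_mul_of_nonpos_right ht.2 hw)
  · have h1 : t * chemPotPlusTT' 1 τ u n ≤ t * m_hi := mul_le_mul_of_nonneg_left hhi ht0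
    refine h1.trans ?_
    rcases le_total 0 m_hi with hw | hw
    · exact le_trans (mul_le_mul_of_nonneg_right ht.2 hw) (le_max_right _ _)
    · exact le_trans (mul_le_mul_of_nonpos_right ht.1 hw) (le_max_left _ _)

end ThermodynamicLimit

/-! ### §4 Thermal states and fields: the Gibbs state of `c • H` at `β` is the Gibbs state of `H` at `cβ`

The temperature and field axes of a phase map scale like energies. At the level of a finite
Hermitian matrix this is the identity `e^{-β (cH)} = e^{-(βc) H}`: Gibbs weight, partition function
and Gibbs state of `c • H` at inverse temperature `β` are those of `H` at `βc` (no sign or size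
condition on `c`). For the `t–t'` Hubbard torus, with the grand-canonical and Zeeman couplings
`-μ N - h S^z` included (both LINEAR in `(μ, h)`, so `H(ct, ct', cU) - cμ N - ch S^z = c • (H(t, t', U) - μ N - h S^z)`),
every thermal expectation of the physical model `H(t, t', U) - μ N - h S^z` at inverse temperature `β`
equals the corresponding expectation of the UNIT model `H(1, t'/t, U/t) - (μ/t) N - (h/t) S^z` at
`βt` (`t > 0`): a dimensionless thermal word depends on `(U/t, t'/t, μ/t, h/t, k_B T / t)` only, and
the kelvin / tesla axes carry exactly one power of the scale `t_eV` (conversion of a threshold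
`k_B T / t ≥ θ` over a scale box `t_eV ∈ [t₁, t₂]` is plain interval arithmetic, cf.
`Summit.Ventures.CertifiedManyBodySolver.Downfold.IntervalCalculus`). Bratteli–Robinson II §5.3.1
(Gibbs states of finite systems); Ruelle (1969) §3.3. -/

/-- `e^{-β (c • H)} = e^{-(β c) H}`: the Gibbs weight of a rescaled Hamiltonian is the Gibbs weight at
the rescaled inverse temperature (dot-notation extension of Mathlib's `Matrix`; any real `c`).
[cite: Ruelle1969, §3.3] -/
theorem _root_.Matrix.gibbsWeight_real_smul {m : Type*} [Fintype m] [DecidableEq m] (β c : ℝ)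
    (H : Matrix m m ℂ) : Matrix.gibbsWeight β ((c : ℂ) • H) = Matrix.gibbsWeight (β * c) H := by
  simp only [Matrix.gibbsWeight, smul_smul, Complex.ofReal_mul, neg_mul]

/-- `Z(β; c • H) = Z(βc; H)`: the partition function of a rescaled Hamiltonian (dot-notation
extension of Mathlib's `Matrix`; any real `c`). [cite: Ruelle1969, §3.3] -/
theorem _root_.Matrix.partitionFn_real_smul {m : Type*} [Fintype m] [DecidableEq m] (β c : ℝ)
    (H : Matrix m m ℂ) : Matrix.partitionFn β ((c : ℂ) • H) = Matrix.partitionFn (β * c) H := by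
  simp only [Matrix.partitionFn, Matrix.gibbsWeight_real_smul]

/-- **The Gibbs state of `c • H` at `β` is the Gibbs state of `H` at `βc`** (as linear functionals
on observables; dot-notation extension of Mathlib's `Matrix`; any real `c`). [cite: Ruelle1969, §3.3] -/
theorem _root_.Matrix.gibbsState_real_smul {m : Type*} [Fintype m] [DecidableEq m] (β c : ℝ)
    (H : Matrix m m ℂ) : Matrix.gibbsState β ((c : ℂ) • H) = Matrix.gibbsState (β * c) H := by
  simp only [Matrix.gibbsState, Matrix.partitionFn_real_smul, Matrix.gibbsWeight_real_smul]

/-- Thermal ENERGIES carry one power of the scale: `⟨c • H⟩_{β, c • H} = c ⟨H⟩_{βc, H}`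
(dot-notation extension of Mathlib's `Matrix`). [cite: Ruelle1969, §3.3] -/
theorem _root_.Matrix.gibbsState_real_smul_self {m : Type*} [Fintype m] [DecidableEq m] (β c : ℝ)
    (H : Matrix m m ℂ) :
    Matrix.gibbsState β ((c : ℂ) • H) ((c : ℂ) • H) = (c : ℂ) * Matrix.gibbsState (β * c) H H := by
  rw [Matrix.gibbsState_real_smul, map_smul, smul_eq_mul]

/-- The grand-canonical `t–t'` torus Hamiltonian with a Zeeman field is LINEAR in all five couplings:
`H(ct, ct', cU) - (cμ) N - (ch) S^z = c • (H(t, t', U) - μ N - h S^z)`. [cite: XuEtAl2024, eq. (1)] -/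
theorem hubbardTorusTT'_sub_chemPot_sub_field_smul (L : ℕ) (c t t' U μ h : ℝ) :
    hubbardTorusTT' L (c * t) (c * t') (c * U) - ((c * μ : ℝ) : ℂ) • totalNumber
        - ((c * h : ℝ) : ℂ) • spinZ =
      (c : ℂ) • (hubbardTorusTT' L t t' U - (μ : ℂ) • totalNumber - (h : ℂ) • spinZ) := by
  rw [hubbardTorusTT'_smul, smul_sub, smul_sub, smul_smul, smul_smul, Complex.ofReal_mul,
    Complex.ofReal_mul]

/-- **Canonical thermal states are scale-covariant**: the Gibbs state of `H(ct, ct', cU)` at `β` is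
the Gibbs state of `H(t, t', U)` at `βc` (any real `c`; as functionals on all observables, in
particular on every sector projection, so sector-restricted thermal averages are covered too).
[cite: XuEtAl2024, eq. (1)] [cite: Ruelle1969, §3.3] -/
theorem gibbsState_hubbardTorusTT'_scale (L : ℕ) (β c t t' U : ℝ) :
    Matrix.gibbsState β (hubbardTorusTT' L (c * t) (c * t') (c * U)) =
      Matrix.gibbsState (β * c) (hubbardTorusTT' L t t' U) := by
  rw [hubbardTorusTT'_smul, Matrix.gibbsState_real_smul]

/-- **Grand-canonical thermal states with a field are scale-covariant**: the Gibbs state of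
`H(ct, ct', cU) - (cμ) N - (ch) S^z` at `β` is the Gibbs state of `H(t, t', U) - μ N - h S^z` at `βc`.
[cite: XuEtAl2024, eq. (1)] [cite: Ruelle1969, §3.3] -/
theorem gibbsState_hubbardTorusTT'_grandCanonical_scale (L : ℕ) (β c t t' U μ h : ℝ) :
    Matrix.gibbsState β (hubbardTorusTT' L (c * t) (c * t') (c * U) - ((c * μ : ℝ) : ℂ) • totalNumber
        - ((c * h : ℝ) : ℂ) • spinZ) =
      Matrix.gibbsState (β * c) (hubbardTorusTT' L t t' U - (μ : ℂ) • totalNumber - (h : ℂ) • spinZ) := by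
  rw [hubbardTorusTT'_sub_chemPot_sub_field_smul, Matrix.gibbsState_real_smul]

/-- The grand-canonical partition function is scale-covariant:
`Z(β; H(ct, ct', cU) - cμ N - ch S^z) = Z(βc; H(t, t', U) - μ N - h S^z)` (free energies, entropies and
specific heats of the physical model are read off the unit model at `βt`). [cite: Ruelle1969, §3.3] -/
theorem partitionFn_hubbardTorusTT'_grandCanonical_scale (L : ℕ) (β c t t' U μ h : ℝ) :
    Matrix.partitionFn β (hubbardTorusTT' L (c * t) (c * t') (c * U) - ((c * μ : ℝ) : ℂ) • totalNumber
        - ((c * h : ℝ) : ℂ) • spinZ) =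
      Matrix.partitionFn (β * c) (hubbardTorusTT' L t t' U - (μ : ℂ) • totalNumber - (h : ℂ) • spinZ) := by
  rw [hubbardTorusTT'_sub_chemPot_sub_field_smul, Matrix.partitionFn_real_smul]

/-- **THE DIMENSIONLESS RESCALING LEMMA AT `T > 0` (unit form).** For `t > 0`, every thermal
expectation of the physical grand-canonical `t–t'` torus `H(t, t', U) - μ N - h S^z` at inverse
temperature `β` is the corresponding expectation of the unit model `H(1, t'/t, U/t) - (μ/t) N - (h/t) S^z`
at `βt`: thermal words depend on `(U/t, t'/t, μ/t, h/t, k_B T/t)` only; the kelvin and tesla axes of a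
phase map carry one power of the scale `t`. [cite: XuEtAl2024, eq. (1)] [cite: Ruelle1969, §3.3] -/
theorem gibbsState_hubbardTorusTT'_grandCanonical_eq_unit (L : ℕ) (β : ℝ) {t : ℝ} (ht : 0 < t)
    (t' U μ h : ℝ) :
    Matrix.gibbsState β (hubbardTorusTT' L t t' U - (μ : ℂ) • totalNumber - (h : ℂ) • spinZ) =
      Matrix.gibbsState (β * t)
        (hubbardTorusTT' L 1 (t' / t) (U / t) - ((μ / t : ℝ) : ℂ) • totalNumber
          - ((h / t : ℝ) : ℂ) • spinZ) := by
  have hs := gibbsState_hubbardTorusTT'_grandCanonical_scale L β t 1 (t' / t) (U / t) (μ / t) (h / t)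
  rwa [mul_one, mul_div_cancel₀ _ ht.ne', mul_div_cancel₀ _ ht.ne', mul_div_cancel₀ _ ht.ne',
    mul_div_cancel₀ _ ht.ne'] at hs

/-- Canonical unit form: for `t > 0` the Gibbs state of `H(t, t', U)` at `β` is the Gibbs state of
`H(1, t'/t, U/t)` at `βt`. [cite: XuEtAl2024, eq. (1)] -/
theorem gibbsState_hubbardTorusTT'_eq_unit (L : ℕ) (β : ℝ) {t : ℝ} (ht : 0 < t) (t' U : ℝ) :
    Matrix.gibbsState β (hubbardTorusTT' L t t' U) =
      Matrix.gibbsState (β * t) (hubbardTorusTT' L 1 (t' / t) (U / t)) := by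
  have hs := gibbsState_hubbardTorusTT'_scale L β t 1 (t' / t) (U / t)
  rwa [mul_one, mul_div_cancel₀ _ ht.ne', mul_div_cancel₀ _ ht.ne'] at hs

end Literature.MathematicalPhysics.QuantumLattice

end
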